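/-
Copyright (c) 2026 the pub-hodgecm-mathlib formalisation cell (harness21).  Prover seat hodgecm-mathlib-LH4-p12 (g4), Track A «(D-RAM) FOUR-FRAME», unit U2H, the census leaf
(ρ2b′-X) `stub_U2H_fixedPointCensus_typeTwo_unit0` — RHO2BX-ORDER v1 (payer LH4-p14 (g3)) organ O-Cone: the WEIGHTED cone index-set census (finsum transport for O-Sum).  2026-09-04.
-/
import Summits.HodgeConjecture.HodgeConjecture.Theorems.F0P3cDyRamConeLevelCensus   -- ★ p857377 census; brings ★ (L→) p857361, ★ (L←) p857341, ★ (C)(D), ★ (A)(B)(C′), ★ (W), ★ DEFS leaf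
import HarnessLib

/-!
# Crux `H413`, line LH4 «(D-RAM) FOUR-FRAME», leaf (ρ2b′-X) — organ O-Cone, the WEIGHTED CONE INDEX-SET CENSUS at tube `b ≥ 1`:
# `Σᶠ_{B ∈ S_b} g(B) = Σ_{j ≤ J} [lam ∈ 𝒪_j] · Σᶠ_{Λ ∈ levelSetDep(j, b; lam − jE u)} f j Λ` whenever `g(B) = f j (φB)` on the cells

Cell `hodgecm-mathlib` (D-0151), FLOOR 0, crux H413 = `stmt-HodgeConjecture-24833`, unit U2H, leaf (ρ2b′-X) (OPEN-CONFIRMED, T18-55); RHO2BX-ORDER v1 organ **O-Cone** (LH4-p12 (g4)).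
THEOREMS ONLY (no `def`, no instance, no notation, no `sorry`); lane `--supports stmt-HodgeConjecture-24833 --as helper` (count-neutral).  WHY: the cone terms of the G-side census
are WEIGHTED sums `Σ_{b ≥ 1} Σᶠ_{B} #fibre^Γ(B, b)` (★ fibration p857312 LH4-p07 (g6); fibre counts ★ T2b p857229 `#Sol_{2b}(r_B)` ∕ ★ T2c p857252), not bare cardinalities; ★ p857377
`ncard_coneWParts_eq_sum` counts the index set `S_b` and THIS FILE transports an arbitrary weight `g : W-parts → N` that is read on the line model (`g B = f j (φB)` whenever `φB ∈
levelSetDep(j, b; lam − jE u)`, `lam ∈ 𝒪_j` — e.g. `#Sol_{2b}` at `jE r = glueUnit(x₀, b)` by the glue-norm transport) to `Σ_{j ≤ J} [lam ∈ 𝒪_j]·Σᶠ_{Λ ∈ levelSetDep(j,b;μ)} f j Λ`,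
which the T5a∕b∕c tables evaluate.  Ingredients: ★ (L→)∕(L←), ★ `map_toAddSubgroup_injective` (`finsum_mem_image`), disjointness in `j` (★ `eq_of_mem_levelSet_of_mem_levelSet`),
truncation at `J` (★ `not_isOrd_pow_of_lt`).
* §1 `finsum_mem_iUnion_eq_sum_of_disjoint` — weighted twin of ★ `ncard_iUnion_eq_sum_of_disjoint`.
* §2 **`finsum_coneWParts_eq_sum`**.
HONEST LABEL: count-neutral; HC_CM is proved only modulo the 7 printed citations (2 remaining named inputs: hLiu418 = `stmt-HodgeConjecture-24832`, h413 = `stmt-HodgeConjecture-24833`) until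
rung 0 closes.

## References
* [Kottwitz1986BaseChangeUnits] R. E. Kottwitz, *Base change for unit elements of Hecke algebras*, Compositio Math. 60 (1986), §1 pp. 240–241.
* [Jacobowitz1962] R. Jacobowitz, *Hermitian forms over local fields*, Amer. J. Math. 84 (1962), §4.
* [BruhatTits1972] F. Bruhat, J. Tits, *Groupes réductifs sur un corps local I*, Publ. Math. IHÉS 41 (1972), §10.
-/

set_option autoImplicit false

noncomputable section

open scoped Valued WithZero Matrix MatrixGroups
open WithZero
open scoped Classical
open Literature.NumberTheory.Automorphic Literature.NumberTheory.Automorphic.HermitianLattice Literature.NumberTheory.Automorphic.UnitaryLatticeTree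
open Literature.NumberTheory.Automorphic.EllipticPlaneAsFieldLine
open Literature.NumberTheory.LocalFields.QuadraticOrder
open Summit.HodgeConjecture.HodgeConjecture.Cruxes.H413.F0P3cDyRamToricCensusDefs
open Summit.HodgeConjecture.HodgeConjecture.Cruxes.H413.F0P3cDyRamWSideOrderCensus

namespace Summit.HodgeConjecture.HodgeConjecture.Cruxes.H413.F0P3cDyRamConeLevelTransport

variable {E M : Type*} [Field E] [Valued E ℤᵐ⁰] [Field M] [Valued M ℤᵐ⁰] {ρ Θ : M →+* M} {α : M}

/-! ## §1 A weighted disjoint, eventually empty union -/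

/-- A disjoint family of finite sets, empty beyond `J`, has `Σᶠ_{⋃} f = Σ_{j ≤ J} Σᶠ_{S j} f`. [cite: Kottwitz1986BaseChangeUnits, §1 pp. 240–241] -/
theorem finsum_mem_iUnion_eq_sum_of_disjoint {X N : Type*} [AddCommMonoid N] (S : ℕ → Set X) (f : X → N) (hfin : ∀ j, (S j).Finite)
    (hdisj : ∀ i j, i ≠ j → Disjoint (S i) (S j)) {J : ℕ} (hempty : ∀ j, J < j → S j = ∅) :
    ∑ᶠ x ∈ ⋃ j, S j, f x = ∑ j ∈ Finset.range (J + 1), ∑ᶠ x ∈ S j, f x := by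
  classical
  have hUnion : (⋃ j : ℕ, S j) = ⋃ j ∈ Finset.range (J + 1), S j := by
    ext x
    simp only [Set.mem_iUnion, Finset.mem_range, exists_prop]
    constructor
    · rintro ⟨j, hj⟩
      refine ⟨j, ?_, hj⟩
      by_contra hJj
      have : S j = ∅ := hempty j (by omega)
      rw [this] at hj; exact hj
    · rintro ⟨j, -, hj⟩; exact ⟨j, hj⟩
  rw [hUnion]
  have hgen : ∀ n : ℕ, ∑ᶠ x ∈ ⋃ j ∈ Finset.range n, S j, f x = ∑ j ∈ Finset.range n, ∑ᶠ x ∈ S j, f x := by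
    intro n
    induction n with
    | zero => simp
    | succ n ih =>
      rw [Finset.range_add_one, Finset.sum_insert Finset.notMem_range_self, Finset.set_biUnion_insert]
      have hd : Disjoint (S n) (⋃ x ∈ Finset.range n, S x) := by
        rw [Set.disjoint_left]
        intro x hn hU
        simp only [Set.mem_iUnion, Finset.mem_range, exists_prop] at hU
        obtain ⟨j, hj, hxj⟩ := hU
        exact (Set.disjoint_left.1 (hdisj n j (by omega))) hn hxj
      rw [finsum_mem_union hd (hfin n) ?_, ih]
      exact (Finset.range n).finite_toSet.biUnion fun j _ => hfin j
  exact hgen (J + 1)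

/-! ## §2 The weighted census -/

/-- **THE WEIGHTED CONE INDEX-SET CENSUS at tube `b ≥ 1`.**  For any weight `g` on W-parts that is READ ON THE LINE MODEL — `g B = f j (φB)` whenever `φB ∈ levelSetDep(j, b; lam − jE u)`
and `lam ∈ 𝒪_j` — one has `Σᶠ_{B ∈ S_b} g B = Σ_{j ≤ J} [lam ∈ 𝒪_j] · Σᶠ_{Λ ∈ levelSetDep(j, b; lam − jE u)} f j Λ` (`S_b` = the cone W-parts at tube `b`: full, `γ₂`-fixed, with a
dual generator `w₀` carrying (G1), `B^♯ = B + 𝒪w₀`, `|⟨w₀,w₀⟩|·|ϖ|^{2b} = 1` and the tube criterion; `lam ∉ 𝒪_{J+1}`; `levelSet(j, b)` finite for `j ≤ J`).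
[cite: Jacobowitz1962, §4] [cite: Kottwitz1986BaseChangeUnits, §1 pp. 240–241] [cite: BruhatTits1972, §10] -/
theorem finsum_coneWParts_eq_sum {N : Type*} [AddCommMonoid N] (σ : E →+* E) {ϖ : E} (hϖ0 : ϖ ≠ 0) (hϖ1 : Valued.v ϖ < 1) (H₂ : Matrix (Fin 2) (Fin 2) E) (jE : E →+* M)
    (hρρ : ∀ x, ρ (ρ x) = x) (hvρ : ∀ x, Valued.v (ρ x) = Valued.v x) (hα : ρ α ≠ α) (hα1 : Valued.v α ≤ 1)
    (hint : ∀ z : M, Valued.v z ≤ 1 → Valued.v ((z - ρ z) / (α - ρ α)) ≤ 1)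
    (hΘΘ : ∀ x, Θ (Θ x) = x) (hΘρ : ∀ x, Θ (ρ x) = ρ (Θ x)) (hvΘ : ∀ x, Valued.v (Θ x) = Valued.v x)
    (hjv : ∀ c, Valued.v (jE c) ≤ 1 ↔ Valued.v c ≤ 1) (hjfix : ∀ z, ρ z = z ↔ ∃ c, jE c = z)
    (hjpow : ∀ (t : E) (n : ℤ), Valued.v (jE t) = Valued.v (jE ϖ) ^ n ↔ Valued.v t = Valued.v ϖ ^ n)
    (hEval : ∀ c : M, ρ c = c → c ≠ 0 → Valued.v c ≤ 1 → ∃ n : ℕ, Valued.v c = Valued.v (jE ϖ) ^ n)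
    (hϖmax : ∀ t : M, ρ t = t → Valued.v t < 1 → Valued.v t ≤ Valued.v (jE ϖ))
    (φ : (Fin 2 → E) →+ M) (hφs : ∀ (c : E) (x : Fin 2 → E), φ (c • x) = jE c * φ x) (hφi : Function.Injective φ) (hφo : Function.Surjective φ)
    {γ₂ : GL (Fin 2) E} {lam h : M} (hφγ : ∀ x, φ ((γ₂ : Matrix (Fin 2) (Fin 2) E).mulVec x) = lam * φ x) (hlam : Valued.v lam = 1)
    (hΘh : Θ h = h) (hh : h ≠ 0) (hform : ∀ x y, jE (pairing σ H₂ x y) = h * Θ (φ x) * φ y + ρ (h * Θ (φ x) * φ y))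
    {u : E} (hu : Valued.v u ≤ 1) {b : ℕ} (hb : 1 ≤ b) {J : ℕ} (hJ : ¬ IsOrd ρ α (jE ϖ ^ (J + 1)) lam)
    (hfin : ∀ j, j ≤ J → (levelSet ρ Θ α (jE ϖ) h j b).Finite)
    (g : Submodule 𝒪[E] (Fin 2 → E) → N) (f : ℕ → AddSubgroup M → N)
    (hfg : ∀ (j : ℕ) (B : Submodule 𝒪[E] (Fin 2 → E)), B.toAddSubgroup.map φ ∈ levelSetDep ρ Θ α (jE ϖ) h j b (lam - jE u) → IsOrd ρ α (jE ϖ ^ j) lam →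
      g B = f j (B.toAddSubgroup.map φ)) :
    ∑ᶠ B ∈ {B : Submodule 𝒪[E] (Fin 2 → E) | (∃ g : GL (Fin 2) E, B = latt (g : Matrix (Fin 2) (Fin 2) E)) ∧ mapGL γ₂ B = B ∧
        ∃ w₀ : Fin 2 → E, (∀ w, w ∈ B ↔ (w ∈ dualLatt σ H₂ B ∧ Valued.v (pairing σ H₂ w₀ w) ≤ 1)) ∧
          (∀ w ∈ dualLatt σ H₂ B, ∃ (t : E) (a : Fin 2 → E), Valued.v t ≤ 1 ∧ a ∈ B ∧ w = t • w₀ + a) ∧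
          Valued.v (pairing σ H₂ w₀ w₀) * Valued.v ϖ ^ (2 * b) = 1 ∧ (γ₂ : Matrix (Fin 2) (Fin 2) E).mulVec w₀ - u • w₀ ∈ B}, g B =
      ∑ j ∈ Finset.range (J + 1), (if IsOrd ρ α (jE ϖ ^ j) lam then ∑ᶠ Λ ∈ levelSetDep ρ Θ α (jE ϖ) h j b (lam - jE u), f j Λ else 0) := by
  classical
  have hρϖ : ρ (jE ϖ) = jE ϖ := (hjfix _).2 ⟨ϖ, rfl⟩
  have hϖE0 : jE ϖ ≠ 0 := (map_ne_zero jE).2 hϖ0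
  have hϖE1 : Valued.v (jE ϖ) < 1 := by
    refine lt_of_le_of_ne ((hjv ϖ).2 hϖ1.le) fun hle => ?_
    have := (hjpow ϖ 0).1 (by rw [zpow_zero]; exact hle)
    rw [zpow_zero] at this
    exact hϖ1.ne this
  set S : Set (Submodule 𝒪[E] (Fin 2 → E)) := {B : Submodule 𝒪[E] (Fin 2 → E) | (∃ g : GL (Fin 2) E, B = latt (g : Matrix (Fin 2) (Fin 2) E)) ∧ mapGL γ₂ B = B ∧
      ∃ w₀ : Fin 2 → E, (∀ w, w ∈ B ↔ (w ∈ dualLatt σ H₂ B ∧ Valued.v (pairing σ H₂ w₀ w) ≤ 1)) ∧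
        (∀ w ∈ dualLatt σ H₂ B, ∃ (t : E) (a : Fin 2 → E), Valued.v t ≤ 1 ∧ a ∈ B ∧ w = t • w₀ + a) ∧
        Valued.v (pairing σ H₂ w₀ w₀) * Valued.v ϖ ^ (2 * b) = 1 ∧ (γ₂ : Matrix (Fin 2) (Fin 2) E).mulVec w₀ - u • w₀ ∈ B} with hS
  set T : ℕ → Set (Submodule 𝒪[E] (Fin 2 → E)) := fun j =>
    {B | B ∈ S ∧ B.toAddSubgroup.map φ ∈ levelSetDep ρ Θ α (jE ϖ) h j b (lam - jE u) ∧ IsOrd ρ α (jE ϖ ^ j) lam} with hT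
  -- `S` is the disjoint union of the `T j`
  have hST : S = ⋃ j, T j := by
    ext B
    simp only [Set.mem_iUnion, hT, Set.mem_setOf_eq]
    constructor
    · intro hB
      obtain ⟨hBg, hfix, w₀, hG1, hgen, hw₀, hdep⟩ := hB
      obtain ⟨j, hj, hlamj⟩ := exists_mem_levelSetDep_map σ hϖ0 hϖ1 H₂ jE hρρ hvρ hα hα1 hint hΘΘ hΘρ hvΘ hjv hjfix hjpow hEval hϖmax φ hφs hφi hφo
        hφγ hlam hΘh hh hform hu hb hBg hfix hG1 hgen hw₀ hdep
      exact ⟨j, ⟨hBg, hfix, w₀, hG1, hgen, hw₀, hdep⟩, hj, hlamj⟩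
    · rintro ⟨j, hB, -, -⟩; exact hB
  have hTempty' : ∀ j, ¬ IsOrd ρ α (jE ϖ ^ j) lam → T j = ∅ := by
    intro j hj
    ext B
    simp only [hT, Set.mem_setOf_eq, Set.mem_empty_iff_false, iff_false, not_and]
    exact fun _ _ => hj
  have hTempty : ∀ j, J < j → T j = ∅ := fun j hj => hTempty' j (not_isOrd_pow_of_lt hϖE1.le hJ hj)
  have hinj : ∀ j, Set.InjOn (fun B : Submodule 𝒪[E] (Fin 2 → E) => B.toAddSubgroup.map φ) (T j) :=
    fun j B _ B' _ hBB' => map_toAddSubgroup_injective φ hφi hBB'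
  -- the image of `T j` is the depth-refined level set (when `lam ∈ 𝒪_j`)
  have himage : ∀ j, IsOrd ρ α (jE ϖ ^ j) lam →
      (fun B : Submodule 𝒪[E] (Fin 2 → E) => B.toAddSubgroup.map φ) '' T j = levelSetDep ρ Θ α (jE ϖ) h j b (lam - jE u) := by
    intro j hlamj
    ext Λ
    simp only [Set.mem_image, hT, Set.mem_setOf_eq]
    constructor
    · rintro ⟨B, ⟨-, hj, -⟩, rfl⟩; exact hj
    · intro hΛ
      obtain ⟨B, hBΛ, hBg, hfix, w₀, hG1, hgen, hw₀, hdep⟩ := exists_coneData_of_mem_levelSetDep σ hϖ0 hϖ1 H₂ jE hρρ hvρ hα hα1 hint hΘΘ hΘρ hvΘ hjv hjfix hjpow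
        hϖmax φ hφs hφi hφo hφγ hlam hΘh hh hform u hb hΛ hlamj
      exact ⟨B, ⟨⟨hBg, hfix, w₀, hG1, hgen, hw₀, hdep⟩, by rw [hBΛ]; exact hΛ, hlamj⟩, hBΛ⟩
  have hTfin : ∀ j, (T j).Finite := by
    intro j
    by_cases hlamj : IsOrd ρ α (jE ϖ ^ j) lam
    · by_cases hj : j ≤ J
      · refine Set.Finite.of_finite_image ?_ (hinj j)
        rw [himage j hlamj]
        exact (hfin j hj).subset (levelSetDep_subset ρ Θ α (jE ϖ) h j b (lam - jE u))
      · rw [hTempty j (by omega)]; exact Set.finite_empty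
    · rw [hTempty' j hlamj]; exact Set.finite_empty
  have hTdisj : ∀ i j, i ≠ j → Disjoint (T i) (T j) := by
    intro i j hij
    rw [Set.disjoint_left]
    intro B hi hj
    exact hij (eq_of_mem_levelSet_of_mem_levelSet hvρ hα hα1 hint hρϖ hϖE0 hϖE1 h
      (levelSetDep_subset ρ Θ α (jE ϖ) h i b (lam - jE u) hi.2.1) (levelSetDep_subset ρ Θ α (jE ϖ) h j b (lam - jE u) hj.2.1))
  rw [hST, finsum_mem_iUnion_eq_sum_of_disjoint T g hTfin hTdisj hTempty]
  refine Finset.sum_congr rfl fun j _ => ?_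
  split_ifs with hlamj
  · rw [← himage j hlamj, finsum_mem_image (hinj j)]
    exact finsum_mem_congr rfl fun B hB => hfg j B hB.2.1 hlamj
  · rw [hTempty' j hlamj, finsum_mem_empty]

end Summit.HodgeConjecture.HodgeConjecture.Cruxes.H413.F0P3cDyRamConeLevelTransport

end
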